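import Summits.NavierStokesRegularity.FluidComputer.PalasekTowerWeightDoor

/-!
# THE WEIGHT DOOR, FIRST LEMMA WITH A SOURCE: weighted linearised enstrophy of a FORCED linearised
# solution under a curl-pairing certificate — `√E(t) ≤ (√E(0) + ∫₀ᵗ R) e^{∫₀ᵗ Λ}`

Cell `ns-blowup`, seat `ns-palasek-20303-p1` (LEAD prover on stmt-NavierStokesRegularity-20303 `EpisodeBaseT`;
route `PalasekTowerBreakdown`, rev 19; crux idea `weightdoor`, route (C) of the certificate road). Sequel of
`PalasekTowerWeightDoor.lean` (p533551: the homogeneous first lemma). LABEL: E–C analysis (KERNEL: one theorem;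
no definition, no named fact, no `sorry`; register-free). WHAT THIS IS NOT: not Navier–Stokes evidence — a linear
energy inequality for a GIVEN forced linearised solution under a GIVEN certificate; no design, weight, certificate
or run is exhibited; the NONLINEAR door of route (C) is not in this file.

## Why the source

The nonlinear a-posteriori door of route (C) treats the difference `f = v − w` of the true free run `v` and the
design `w` as a solution of the system LINEARISED at `w` with SOURCE `g = −(f·∇)f − r` (`r` the design's residual):
`∂ₜf + (w·∇)f + (f·∇)w = Δf − ∇π + g`. Its linear core is therefore the first lemma WITH a source, in the
square-root Grönwall shape of the tree's strain-currency `L²` door (`sqrt_le_mul_exp_of_le_add_intervalIntegral`,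
fc-prover-3 p520809): if the design carries the curl-pairing certificate `curlPairing (w t) ϑ² v ≤ 2Λ(t)∫ϑ²|curl v|²`
(`WeightDoor.CurlPairingCertificate`) and the weighted curl of the source is bounded in `L²`,
`∫ ϑ² |curl g(t)|² ≤ R(t)²`, then

  `√(∫ ϑ² |curl f(t)|²) ≤ (√(∫ ϑ² |curl f(0)|²) + ∫₀ᵗ R) · exp(∫₀ᵗ Λ)`     (`weightedEnstrophy_sqrt_le_of_curlPairingCertificate_forced`).

Proof: as in the homogeneous lemma — the `L²` balance of `ϑ · curl f` (`IsSmoothSpaceTimeOn.l2_balance`),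
`∂ₜ curl f = curl ∂ₜf`, the curl of the linearised momentum equation (`curl ∇π = 0`; now `+ curl g`), the
certificate at the slice `f(t)`, Cauchy–Schwarz `2∫ϑ²⟪curl f, curl g⟫ ≤ 2 √E · R`
(`integral_norm_mul_norm_le_sqrt_mul_sqrt`), and the square-root Grönwall lemma.

References: Th. Gallay, Y. Maekawa, Comm. Math. Phys. 302 (2011) [cite: GallayMaekawa2010, Thm. 1.1]; Th. Gallay,
C. E. Wayne, Comm. Math. Phys. 255 (2005) [cite: GallayWayne2005, Thm. 1.1]; M. Dashti, J. C. Robinson, SIAM J. Numer.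
Anal. 46 (2008), Thm. 5 [cite: DashtiRobinson2008, Thm. 5]; J. C. Robinson, J. L. Rodrigo, W. Sadowski, CUP 2016,
Thm. 6.10 [cite: RobinsonRodrigoSadowski2016, Thm. 6.10 (proof), (6.3)].
-/

noncomputable section

namespace Summit.NavierStokesRegularity.FluidComputer.PalasekTowerClayBridge.WeightDoor

open Set MeasureTheory Metric Function InnerProductSpace Filter Topology
open scoped ENNReal NNReal ContDiff RealInnerProductSpace Laplacian
open Literature.Analysis Literature.Analysis.FluidPDE

/-- A field on `ℝ³` bounded by `C (1 + ‖x‖)⁻²` has `∫ ‖·‖² ≤ C² ∫ (1 + ‖x‖)⁻⁴`. (Plumbing; the private twin of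
`PalasekTowerWeightDoor`.) [folklore] -/
private theorem lintegral_enorm_sq_le_of_decay_two' {F : Type*} [NormedAddCommGroup F]
    {g : EuclideanSpace ℝ (Fin 3) → F} {C : ℝ}
    (hg : ∀ x, ‖g x‖ ≤ C * (1 + ‖x‖) ^ (-(2 : ℝ))) :
    ∫⁻ x, ‖g x‖ₑ ^ 2 ≤
      ENNReal.ofReal (C ^ 2) * ∫⁻ x : EuclideanSpace ℝ (Fin 3), ENNReal.ofReal ((1 + ‖x‖) ^ (-(4 : ℝ))) := by
  have hpt : ∀ x : EuclideanSpace ℝ (Fin 3),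
      ‖g x‖ₑ ^ 2 ≤ ENNReal.ofReal (C ^ 2) * ENNReal.ofReal ((1 + ‖x‖) ^ (-(4 : ℝ))) := by
    intro x
    have hb : 0 < 1 + ‖x‖ := by positivity
    have h2 : ‖g x‖ ^ 2 ≤ C ^ 2 * (1 + ‖x‖) ^ (-(4 : ℝ)) := by
      calc ‖g x‖ ^ 2 ≤ (C * (1 + ‖x‖) ^ (-(2 : ℝ))) ^ 2 := pow_le_pow_left₀ (norm_nonneg _) (hg x) 2
        _ = C ^ 2 * ((1 + ‖x‖) ^ (-(2 : ℝ)) * (1 + ‖x‖) ^ (-(2 : ℝ))) := by ring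
        _ = C ^ 2 * (1 + ‖x‖) ^ (-(4 : ℝ)) := by rw [← Real.rpow_add hb]; norm_num
    calc ‖g x‖ₑ ^ 2 = ENNReal.ofReal (‖g x‖ ^ 2) := by rw [← ofReal_norm, ENNReal.ofReal_pow (norm_nonneg _)]
      _ ≤ ENNReal.ofReal (C ^ 2 * (1 + ‖x‖) ^ (-(4 : ℝ))) := ENNReal.ofReal_le_ofReal h2
      _ = ENNReal.ofReal (C ^ 2) * ENNReal.ofReal ((1 + ‖x‖) ^ (-(4 : ℝ))) :=
          ENNReal.ofReal_mul (sq_nonneg _)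
  calc ∫⁻ x, ‖g x‖ₑ ^ 2 ≤ ∫⁻ x : EuclideanSpace ℝ (Fin 3),
        ENNReal.ofReal (C ^ 2) * ENNReal.ofReal ((1 + ‖x‖) ^ (-(4 : ℝ))) := lintegral_mono hpt
    _ = ENNReal.ofReal (C ^ 2) * ∫⁻ x : EuclideanSpace ℝ (Fin 3), ENNReal.ofReal ((1 + ‖x‖) ^ (-(4 : ℝ))) :=
        lintegral_const_mul' _ _ ENNReal.ofReal_ne_top

/-- **THE WEIGHT DOOR, FIRST LEMMA WITH A SOURCE.** Let `f` be a classical solution on `[0, T]` (`T > 0`) of the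
Navier–Stokes system linearised at a design `w` with source `g` (`IsClassicalLinearizedNSSolutionOn`), `f` with uniform
Schwartz bounds on the slab, `g(t) ∈ C¹` for `t ∈ [0, T]`; let `ϑ` be a smooth weight amplitude of polynomial growth,
`|ϑ(x)| ≤ C_ϑ (1 + ‖x‖)^m`, `Λ ≥ 0` continuous on `[0, T]` such that the design carries the curl-pairing certificate for
the weight `ϑ²`, and `R ≥ 0` continuous on `[0, T]` with `ϑ · curl g(t)` square integrable and
`∫ ϑ² |curl g(t)|² ≤ R(t)²`. Then for every `t ∈ [0, T]`,
`√(∫ ϑ² |curl f(t)|²) ≤ (√(∫ ϑ² |curl f(0)|²) + ∫₀ᵗ R) · exp(∫₀ᵗ Λ)`.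
[cite: GallayMaekawa2010, Thm. 1.1] [cite: DashtiRobinson2008, Thm. 5] [cite: RobinsonRodrigoSadowski2016, Thm. 6.10 (proof), (6.3)] -/
theorem weightedEnstrophy_sqrt_le_of_curlPairingCertificate_forced {T : ℝ} (hT : 0 < T)
    {w g f : ℝ → EuclideanSpace ℝ (Fin 3) → EuclideanSpace ℝ (Fin 3)} {π : ℝ → EuclideanSpace ℝ (Fin 3) → ℝ}
    (hsol : IsClassicalLinearizedNSSolutionOn (Icc 0 T) w g f π)
    (hd : HasUniformRapidDecayOn (Icc 0 T) f)
    (hg1 : ∀ t ∈ Icc 0 T, ContDiff ℝ 1 (g t))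
    {ϑ : EuclideanSpace ℝ (Fin 3) → ℝ} (hϑ : ContDiff ℝ ∞ ϑ) {Cϑ : ℝ} {m : ℕ}
    (hϑb : ∀ x, |ϑ x| ≤ Cϑ * (1 + ‖x‖) ^ m)
    {Λ : ℝ → ℝ} (hΛc : ContinuousOn Λ (Icc 0 T)) (hΛ0 : ∀ t ∈ Icc 0 T, 0 ≤ Λ t)
    (hcert : CurlPairingCertificate T w (fun x => ϑ x ^ 2) Λ)
    {R : ℝ → ℝ} (hRc : ContinuousOn R (Icc 0 T)) (hR0 : ∀ t ∈ Icc 0 T, 0 ≤ R t)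
    (hgL2 : ∀ t ∈ Icc 0 T, Integrable (fun x => ‖ϑ x • curl (g t) x‖ ^ 2))
    (hR : ∀ t ∈ Icc 0 T, ∫ x, ϑ x ^ 2 * ‖curl (g t) x‖ ^ 2 ≤ R t ^ 2) :
    ∀ t ∈ Icc 0 T, Real.sqrt (∫ x, ϑ x ^ 2 * ‖curl (f t) x‖ ^ 2) ≤
      (Real.sqrt (∫ x, ϑ x ^ 2 * ‖curl (f 0) x‖ ^ 2) + ∫ s in (0 : ℝ)..t, R s) *
        Real.exp (∫ s in (0 : ℝ)..t, Λ s) := by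
  have hU : UniqueDiffOn ℝ (Icc 0 T) := uniqueDiffOn_Icc hT
  have hcl : Icc 0 T ⊆ closure (interior (Icc 0 T)) := by
    rw [interior_Icc, closure_Ioo hT.ne]
  have hf : IsSmoothSpaceTimeOn (Icc 0 T) f := hsol.smooth_velocity
  have hπ : IsSmoothSpaceTimeOn (Icc 0 T) π := hsol.smooth_pressure
  have hCϑ : 0 ≤ Cϑ := by
    have h := hϑb 0
    simp only [norm_zero, add_zero, one_pow, mul_one] at h
    exact (abs_nonneg _).trans h
  -- the vorticity and the weighted vorticity, jointly smooth
  set ζ : ℝ → EuclideanSpace ℝ (Fin 3) → EuclideanSpace ℝ (Fin 3) := vorticity f with hζdef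
  have hζt : ∀ t, ζ t = curl (f t) := fun t => rfl
  have hζ : IsSmoothSpaceTimeOn (Icc 0 T) ζ := by
    have : ζ = fun t x => curlCLM (fderiv ℝ (f t) x) := by funext t x; rfl
    rw [this]; exact (hf.fderiv_slice hU).clm_comp curlCLM
  obtain ⟨W, hWdef⟩ : ∃ W : ℝ → EuclideanSpace ℝ (Fin 3) → EuclideanSpace ℝ (Fin 3),
      W = fun t x => ϑ x • ζ t x := ⟨_, rfl⟩
  have hWtx : ∀ t x, W t x = ϑ x • ζ t x := fun t x => by rw [hWdef]
  have hW : IsSmoothSpaceTimeOn (Icc 0 T) W := by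
    rw [hWdef]
    have h1 : ContDiffOn ℝ ∞ (fun q : ℝ × EuclideanSpace ℝ (Fin 3) => ϑ q.2) (Icc 0 T ×ˢ univ) :=
      (hϑ.comp contDiff_snd).contDiffOn
    exact h1.smul hζ
  -- the time derivatives
  have hft : IsSmoothSpaceTimeOn (Icc 0 T) (FluidPDE.timeDerivWithin (Icc 0 T) f) := hf.timeDerivWithin hU
  have hdt : HasUniformRapidDecayOn (Icc 0 T) (FluidPDE.timeDerivWithin (Icc 0 T) f) := hd.timeDerivWithin hf hU
  have hWt : ∀ t ∈ Icc 0 T, ∀ x, FluidPDE.timeDerivWithin (Icc 0 T) W t x =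
      ϑ x • curl (FluidPDE.timeDerivWithin (Icc 0 T) f t) x := by
    intro t ht x
    rw [timeDerivWithin_apply]
    have h1 : (fun s => W s x) = fun s => ϑ x • ζ s x := by funext s; rw [hWtx]
    rw [h1, derivWithin_fun_const_smul (ϑ x) (hζ.differentiableWithinAt_time ht x),
      ← timeDerivWithin_apply, hf.curl_timeDerivWithin hU hcl ht x]
  -- decay of the vorticity and of its time derivative against the weight
  obtain ⟨C₁, hC₁0, hC₁⟩ := hd.norm_fderiv_le_rpow hf hU (m + 2)
  obtain ⟨C₂, hC₂0, hC₂⟩ := hdt.norm_fderiv_le_rpow hft hU (m + 2)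
  have hweight : ∀ (x : EuclideanSpace ℝ (Fin 3)) (C : ℝ), 0 ≤ C →
      |ϑ x| * (‖curlCLM‖ * (C * (1 + ‖x‖) ^ (-((m + 2 : ℕ) : ℝ)))) ≤
        Cϑ * ‖curlCLM‖ * C * (1 + ‖x‖) ^ (-(2 : ℝ)) := by
    intro x C hC
    have hb : 0 < 1 + ‖x‖ := by positivity
    have hsplit : (1 + ‖x‖) ^ m * (1 + ‖x‖) ^ (-((m + 2 : ℕ) : ℝ)) = (1 + ‖x‖) ^ (-(2 : ℝ)) := by
      rw [← Real.rpow_natCast, ← Real.rpow_add hb]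
      push_cast
      ring_nf
    calc |ϑ x| * (‖curlCLM‖ * (C * (1 + ‖x‖) ^ (-((m + 2 : ℕ) : ℝ))))
        ≤ Cϑ * (1 + ‖x‖) ^ m * (‖curlCLM‖ * (C * (1 + ‖x‖) ^ (-((m + 2 : ℕ) : ℝ)))) :=
          mul_le_mul_of_nonneg_right (hϑb x) (by positivity)
      _ = Cϑ * ‖curlCLM‖ * C * ((1 + ‖x‖) ^ m * (1 + ‖x‖) ^ (-((m + 2 : ℕ) : ℝ))) := by ring
      _ = Cϑ * ‖curlCLM‖ * C * (1 + ‖x‖) ^ (-(2 : ℝ)) := by rw [hsplit]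
  have hnormcurl : ∀ (v : EuclideanSpace ℝ (Fin 3) → EuclideanSpace ℝ (Fin 3)) (x : EuclideanSpace ℝ (Fin 3)),
      ‖curl v x‖ ≤ ‖curlCLM‖ * ‖fderiv ℝ v x‖ := fun v x => by
    rw [curl_eq_curlCLM]; exact curlCLM.le_opNorm _
  have hWbd : ∀ t ∈ Icc 0 T, ∀ x, ‖W t x‖ ≤ Cϑ * ‖curlCLM‖ * C₁ * (1 + ‖x‖) ^ (-(2 : ℝ)) := by
    intro t ht x
    rw [hWtx, norm_smul, Real.norm_eq_abs, hζt]
    exact (mul_le_mul_of_nonneg_left ((hnormcurl (f t) x).trans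
      (mul_le_mul_of_nonneg_left (hC₁ t ht x) (norm_nonneg curlCLM))) (abs_nonneg _)).trans (hweight x C₁ hC₁0)
  have hWtbd : ∀ t ∈ Icc 0 T, ∀ x, ‖FluidPDE.timeDerivWithin (Icc 0 T) W t x‖ ≤
      Cϑ * ‖curlCLM‖ * C₂ * (1 + ‖x‖) ^ (-(2 : ℝ)) := by
    intro t ht x
    rw [hWt t ht x, norm_smul, Real.norm_eq_abs]
    exact (mul_le_mul_of_nonneg_left ((hnormcurl _ x).trans
      (mul_le_mul_of_nonneg_left (hC₂ t ht x) (norm_nonneg curlCLM))) (abs_nonneg _)).trans (hweight x C₂ hC₂0)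
  -- the `L²` bounds of the balance
  set I4 : ℝ≥0∞ := ∫⁻ x : EuclideanSpace ℝ (Fin 3), ENNReal.ofReal ((1 + ‖x‖) ^ (-(4 : ℝ))) with hI4
  have hI4top : I4 ≠ ⊤ :=
    (finite_integral_one_add_norm (by rw [finrank_euclideanSpace, Fintype.card_fin]; norm_num)).ne
  set K₀ : ℝ≥0∞ := ENNReal.ofReal ((Cϑ * ‖curlCLM‖ * C₁) ^ 2) * I4 with hK₀
  set K₁ : ℝ≥0∞ := ENNReal.ofReal ((Cϑ * ‖curlCLM‖ * C₂) ^ 2) * I4 with hK₁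
  have hK₀top : K₀ ≠ ⊤ := ENNReal.mul_ne_top ENNReal.ofReal_ne_top hI4top
  have hK₁top : K₁ ≠ ⊤ := ENNReal.mul_ne_top ENNReal.ofReal_ne_top hI4top
  have hB₀ : ∀ t ∈ Icc 0 T, ∫⁻ x, ‖W t x‖ₑ ^ 2 ≤ (K₀.toNNReal : ℝ≥0∞) := fun t ht => by
    rw [ENNReal.coe_toNNReal hK₀top]
    exact lintegral_enorm_sq_le_of_decay_two' (hWbd t ht)
  have hB₁ : ∀ t ∈ Icc 0 T, ∫⁻ x, ‖FluidPDE.timeDerivWithin (Icc 0 T) W t x‖ₑ ^ 2 ≤ (K₁.toNNReal : ℝ≥0∞) :=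
    fun t ht => by
    rw [ENNReal.coe_toNNReal hK₁top]
    exact lintegral_enorm_sq_le_of_decay_two' (hWtbd t ht)
  -- ### the `L²` balance of the weighted vorticity
  obtain ⟨hΦint, hEcont, hbal⟩ := hW.l2_balance hT hB₀ hB₁
  have hEW : ∀ t, (∫ x, ‖W t x‖ ^ 2) = ∫ x, ϑ x ^ 2 * ‖curl (f t) x‖ ^ 2 := fun t => by
    refine integral_congr_ae (Eventually.of_forall fun x => ?_)
    simp only [hWtx, hζt, norm_smul, Real.norm_eq_abs, mul_pow, sq_abs]
  -- integrability of inner products of continuous `L²` slices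
  have hinner : ∀ {a b : EuclideanSpace ℝ (Fin 3) → EuclideanSpace ℝ (Fin 3)}, Continuous a → Continuous b →
      MemLp a 2 volume → MemLp b 2 volume → Integrable (fun x => ⟪a x, b x⟫) := by
    intro a b ha hb hma hmb
    refine (hma.norm.integrable_mul hmb.norm).mono' (ha.inner hb).aestronglyMeasurable
      (Eventually.of_forall fun x => ?_)
    rw [Real.norm_eq_abs]
    exact abs_real_inner_le_norm _ _
  have hWc : ∀ t ∈ Icc 0 T, Continuous (W t) := fun t ht => (hW.contDiff_slice ht).continuous
  have hWtc : ∀ t ∈ Icc 0 T, Continuous (FluidPDE.timeDerivWithin (Icc 0 T) W t) := fun t ht =>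
    ((hW.timeDerivWithin hU).contDiff_slice ht).continuous
  have hVc : ∀ t ∈ Icc 0 T, Continuous (fun x => ϑ x • curl (g t) x) := fun t ht =>
    hϑ.continuous.smul (continuous_curl (hg1 t ht))
  have hWtmem : ∀ t ∈ Icc 0 T, MemLp (FluidPDE.timeDerivWithin (Icc 0 T) W t) 2 volume := fun t ht =>
    (memLp_two_iff_integrable_sq_norm (hWtc t ht).aestronglyMeasurable).2
      (integrable_sq_norm_of_lintegral_lt_top (hWtc t ht) ((hB₁ t ht).trans_lt ENNReal.coe_lt_top))
  have hWmem : ∀ t ∈ Icc 0 T, MemLp (W t) 2 volume := fun t ht =>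
    (memLp_two_iff_integrable_sq_norm (hWc t ht).aestronglyMeasurable).2
      (integrable_sq_norm_of_lintegral_lt_top (hWc t ht) ((hB₀ t ht).trans_lt ENNReal.coe_lt_top))
  have hVmem : ∀ t ∈ Icc 0 T, MemLp (fun x => ϑ x • curl (g t) x) 2 volume := fun t ht =>
    (memLp_two_iff_integrable_sq_norm (hVc t ht).aestronglyMeasurable).2 (hgL2 t ht)
  -- ### the flux is the raw curl pairing plus the weighted source pairing
  have hflux : ∀ t ∈ Icc 0 T, (∫ x, 2 * ⟪W t x, FluidPDE.timeDerivWithin (Icc 0 T) W t x⟫) =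
      curlPairing (w t) (fun x => ϑ x ^ 2) (f t) + ∫ x, 2 * ⟪W t x, ϑ x • curl (g t) x⟫ := by
    intro t ht
    have hmom : ∀ y, FluidPDE.timeDerivWithin (Icc 0 T) f t y =
        (((Δ (f t)) y - convect (w t) (f t) y - convect (f t) (w t) y) - gradient (π t) y) + g t y := by
      intro y
      have h := hsol.momentum t ht y
      have h' : FluidPDE.timeDerivWithin (Icc 0 T) f t y =
          (FluidPDE.timeDerivWithin (Icc 0 T) f t y + convect (w t) (f t) y + convect (f t) (w t) y) -
            convect (w t) (f t) y - convect (f t) (w t) y := by abel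
      rw [h', h]; abel
    have hdP : ∀ y, DifferentiableAt ℝ (gradient (π t)) y := fun y =>
      (((hπ.gradient hU).contDiff_slice ht).differentiable (by simp)).differentiableAt
    have hdg : ∀ y, DifferentiableAt ℝ (g t) y := fun y => ((hg1 t ht).differentiable one_ne_zero).differentiableAt
    have hdT : ∀ y, DifferentiableAt ℝ (FluidPDE.timeDerivWithin (Icc 0 T) f t) y := fun y =>
      ((hft.contDiff_slice ht).differentiable (by simp)).differentiableAt
    have hdiffB : ∀ y, DifferentiableAt ℝ
        (fun z => ((Δ (f t)) z - convect (w t) (f t) z - convect (f t) (w t) z) - gradient (π t) z) y := by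
      intro y
      have heq : (fun z => ((Δ (f t)) z - convect (w t) (f t) z - convect (f t) (w t) z) - gradient (π t) z) =
          fun z => FluidPDE.timeDerivWithin (Icc 0 T) f t z - g t z := by
        funext z; rw [hmom z]; abel
      rw [heq]
      exact (hdT y).sub (hdg y)
    have hdiffA : ∀ y, DifferentiableAt ℝ
        (fun z => (Δ (f t)) z - convect (w t) (f t) z - convect (f t) (w t) z) y := by
      intro y
      have heq : (fun z => (Δ (f t)) z - convect (w t) (f t) z - convect (f t) (w t) z) =
          fun z => (FluidPDE.timeDerivWithin (Icc 0 T) f t z - g t z) + gradient (π t) z := by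
        funext z; rw [hmom z]; abel
      rw [heq]
      exact ((hdT y).sub (hdg y)).add (hdP y)
    have hcurl : ∀ x, curl (FluidPDE.timeDerivWithin (Icc 0 T) f t) x =
        curl (fun y => (Δ (f t)) y - convect (w t) (f t) y - convect (f t) (w t) y) x + curl (g t) x := by
      intro x
      have heq : FluidPDE.timeDerivWithin (Icc 0 T) f t =
          fun y => (((Δ (f t)) y - convect (w t) (f t) y - convect (f t) (w t) y) - gradient (π t) y) + g t y :=
        funext hmom
      rw [heq, curl_add (hdiffB x) (hdg x), curl_sub (hdiffA x) (hdP x),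
        curl_gradient_eq_zero_holds (π t) ((hπ.contDiff_slice ht).of_le (by norm_cast)) x, sub_zero]
    have hI1 : Integrable (fun x => 2 * ϑ x ^ 2 *
        ⟪curl (f t) x, curl (fun y => (Δ (f t)) y - convect (w t) (f t) y - convect (f t) (w t) y) x⟫) := by
      -- the difference of two integrable functions: the flux and the source pairing
      have hA : Integrable (fun x => 2 * ⟪W t x, FluidPDE.timeDerivWithin (Icc 0 T) W t x⟫) :=
        (hinner (hWc t ht) (hWtc t ht) (hWmem t ht) (hWtmem t ht)).const_mul 2
      have hB : Integrable (fun x => 2 * ⟪W t x, ϑ x • curl (g t) x⟫) :=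
        (hinner (hWc t ht) (hVc t ht) (hWmem t ht) (hVmem t ht)).const_mul 2
      have heq : (fun x => 2 * ϑ x ^ 2 *
          ⟪curl (f t) x, curl (fun y => (Δ (f t)) y - convect (w t) (f t) y - convect (f t) (w t) y) x⟫) =
          fun x => 2 * ⟪W t x, FluidPDE.timeDerivWithin (Icc 0 T) W t x⟫ - 2 * ⟪W t x, ϑ x • curl (g t) x⟫ := by
        funext x
        simp only [hWtx, hWt t ht x, hζt, hcurl x, inner_add_right, real_inner_smul_left, real_inner_smul_right]
        ring
      rw [heq]
      exact hA.sub hB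
    have hI2 : Integrable (fun x => 2 * ⟪W t x, ϑ x • curl (g t) x⟫) :=
      (hinner (hWc t ht) (hVc t ht) (hWmem t ht) (hVmem t ht)).const_mul 2
    rw [curlPairing, ← integral_add hI1 hI2]
    refine integral_congr_ae (Eventually.of_forall fun x => ?_)
    simp only [hWtx, hWt t ht x, hζt, hcurl x, inner_add_right, real_inner_smul_left, real_inner_smul_right]
    ring
  -- ### the certificate and Cauchy–Schwarz at each slice: flux ≤ 2ΛE + 2R√E
  have hslice : ∀ t ∈ Icc 0 T, (∫ x, 2 * ⟪W t x, FluidPDE.timeDerivWithin (Icc 0 T) W t x⟫) ≤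
      2 * Λ t * (∫ x, ‖W t x‖ ^ 2) + 2 * R t * Real.sqrt (∫ x, ‖W t x‖ ^ 2) := by
    intro t ht
    rw [hflux t ht]
    have h1 : curlPairing (w t) (fun x => ϑ x ^ 2) (f t) ≤ 2 * Λ t * ∫ x, ‖W t x‖ ^ 2 := by
      rw [hEW t]
      exact hcert t ht (f t) (hf.contDiff_slice ht) (hd.hasRapidSpatialDecay_slice hf hT ht) (hsol.divFree t ht)
    have h2 : (∫ x, 2 * ⟪W t x, ϑ x • curl (g t) x⟫) ≤ 2 * R t * Real.sqrt (∫ x, ‖W t x‖ ^ 2) := by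
      rw [integral_const_mul]
      have hcs := integral_norm_mul_norm_le_sqrt_mul_sqrt (hWmem t ht) (hVmem t ht)
      have hin : (∫ x, ⟪W t x, ϑ x • curl (g t) x⟫) ≤ ∫ x, ‖W t x‖ * ‖ϑ x • curl (g t) x‖ :=
        integral_mono (hinner (hWc t ht) (hVc t ht) (hWmem t ht) (hVmem t ht))
          ((hWmem t ht).norm.integrable_mul (hVmem t ht).norm) fun x => real_inner_le_norm _ _
      have hVR : Real.sqrt (∫ x, ‖ϑ x • curl (g t) x‖ ^ 2) ≤ R t := by
        have heq : (∫ x, ‖ϑ x • curl (g t) x‖ ^ 2) = ∫ x, ϑ x ^ 2 * ‖curl (g t) x‖ ^ 2 :=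
          integral_congr_ae (Eventually.of_forall fun x => by
            simp only [norm_smul, Real.norm_eq_abs, mul_pow, sq_abs])
        calc Real.sqrt (∫ x, ‖ϑ x • curl (g t) x‖ ^ 2) = Real.sqrt (∫ x, ϑ x ^ 2 * ‖curl (g t) x‖ ^ 2) := by
              rw [heq]
          _ ≤ Real.sqrt (R t ^ 2) := Real.sqrt_le_sqrt (hR t ht)
          _ = R t := Real.sqrt_sq (hR0 t ht)
      have hE0 : 0 ≤ Real.sqrt (∫ x, ‖W t x‖ ^ 2) := Real.sqrt_nonneg _
      calc 2 * ∫ x, ⟪W t x, ϑ x • curl (g t) x⟫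
          ≤ 2 * (Real.sqrt (∫ x, ‖W t x‖ ^ 2) * Real.sqrt (∫ x, ‖ϑ x • curl (g t) x‖ ^ 2)) := by
            linarith [hin.trans hcs]
        _ ≤ 2 * (Real.sqrt (∫ x, ‖W t x‖ ^ 2) * R t) := by gcongr
        _ = 2 * R t * Real.sqrt (∫ x, ‖W t x‖ ^ 2) := by ring
    linarith
  -- ### Grönwall
  set E : ℝ → ℝ := fun t => ∫ x, ‖W t x‖ ^ 2 with hEdef
  have hE0 : ∀ t, 0 ≤ E t := fun t => integral_nonneg fun x => sq_nonneg _
  have hkc : ContinuousOn (fun s => 2 * Λ s * E s + 2 * R s * Real.sqrt (E s)) (Icc 0 T) :=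
    ((continuousOn_const.mul hΛc).mul hEcont).add ((continuousOn_const.mul hRc).mul hEcont.sqrt)
  have hle : ∀ t ∈ Icc 0 T, E t ≤ E 0 + ∫ s in (0 : ℝ)..t, (2 * Λ s * E s + 2 * R s * Real.sqrt (E s)) := by
    intro t ht
    rcases eq_or_lt_of_le ht.1 with h0 | h0
    · rw [← h0, intervalIntegral.integral_same, add_zero]
    have hΦii : IntervalIntegrable
        (fun s => ∫ x, 2 * ⟪W s x, FluidPDE.timeDerivWithin (Icc 0 T) W s x⟫) volume 0 t :=
      (intervalIntegrable_iff_integrableOn_Ioo_of_le h0.le).2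
        (hΦint.mono_set (Ioo_subset_Ioo le_rfl ht.2))
    have hkc' : ContinuousOn (fun s => 2 * Λ s * E s + 2 * R s * Real.sqrt (E s)) (Icc 0 t) :=
      hkc.mono (Icc_subset_Icc le_rfl ht.2)
    have hmono : (∫ s in (0 : ℝ)..t, ∫ x, 2 * ⟪W s x, FluidPDE.timeDerivWithin (Icc 0 T) W s x⟫) ≤
        ∫ s in (0 : ℝ)..t, (2 * Λ s * E s + 2 * R s * Real.sqrt (E s)) :=
      intervalIntegral.integral_mono_on h0.le hΦii (hkc'.intervalIntegrable_of_Icc h0.le)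
        fun s hs => hslice s ⟨hs.1, hs.2.trans ht.2⟩
    have hb := hbal t ⟨h0, ht.2⟩
    show (∫ x, ‖W t x‖ ^ 2) ≤ (∫ x, ‖W 0 x‖ ^ 2) + _
    rw [hb]
    linarith
  have hgr := sqrt_le_mul_exp_of_le_add_intervalIntegral hEcont (fun t _ => hE0 t) hΛc hRc hΛ0 hR0 hle
  intro t ht
  have h1 := hgr t ht
  rw [← hEW t, ← hEW 0]
  exact h1

end Summit.NavierStokesRegularity.FluidComputer.PalasekTowerClayBridge.WeightDoor

end
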